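import Literature.Probability.RandomPlanarGeometry.SLERestrictionHitPathTendsto
import Literature.Probability.RandomPlanarGeometry.SmoothHitPathSteps
import Literature.Probability.RandomPlanarGeometry.LoewnerInverse
import Literature.Analysis.Complex.ConformalQuasiGeodesic
import HarnessLib

/-!
# Discharge of `IsSmoothHull.hitPath_stolz`: the sector claim of [LSW] Lemma 6.3

The named fact `IsSmoothHull.hitPath_stolz` (`SLERestrictionHitPath`) — G. F. Lawler, O. Schramm,
W. Werner, *Conformal restriction: the chordal case*, J. Amer. Math. Soc. **16** (2003),
arXiv:math/0209343, proof of Lemma 6.3, the claim "`β̂(x) := g_T ∘ β(x) - W_T`, `x ∈ [0,1)`, is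
a path which is contained in a sector `|Re z| ≤ c Im z` for some `c`" — is PROVED here
(`IsSmoothHull.hitPath_stolz_holds`), for every continuous driving function `W`.

In print the claim rests on a two-sided Brownian hitting estimate at `z₀` and conformal invariance
of planar Brownian motion. The proof here is by hyperbolic geometry and uses of the hull only that
`int A ⊆ H_T = ℍ ∖ K_T` and `z₀ ∉ H_T`:

1. (*inner cone*) `B(β(x), |β'(1)|(1-x)/8) ⊆ int A` and `|β(x) - z₀| ≍ (1-x)` for `x` near `1`
   (`IsSmoothHitPath.exists_local`: `β` is `C¹` and meets the `C¹` arc `∂A ∩ ℍ` orthogonally);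
2. (*speed*) hence, by Koebe's one-quarter theorem for `g_T - W_T` on that disc
   (`Loewner.mul_norm_deriv_div_four_le_im`), the image curve `w(x) = g_T(β(x)) - W_T ∈ ℍ` has
   hyperbolic speed `|w'|/Im w ≤ 64/(1-x)`;
3. (*distance*) by Koebe's theorem for `f = g_T⁻¹` on the discs `B(u, Im u) ⊆ ℍ`, whose images
   omit `z₀` (`QuasiGeodesic.abs_log_sub_log_le`, `Literature/Analysis/Complex/
   ConformalQuasiGeodesic.lean`), the hyperbolic length of the circle–axis–circle path from
   `w(x₁)` to `w(x₂)` is `≥ ¼ |log(|β x₂ - z₀|/|β x₁ - z₀|)| ≥ ¼ log((1-x₁)/(1-x₂)) - C`;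
4. (*limit*) `w(x) → 0` (`IsSmoothHull.hitPath_tendsto_holds`);
5. so `(arg w, -log|w|)` is a quasi-geodesic of `ℍ` in the sense of
   `Literature/Analysis/Complex/HalfPlaneQuasiGeodesic.lean`, and
   `QuasiGeodesic.IsQuasiGeodesic.eventually_mem_Icc` gives `δ ≤ arg w(x) ≤ π - δ` near `1`,
   i.e. `|Re w| ≤ Im w / sin δ`; on the remaining compact parameter interval `Im w > 0` is
   bounded below and `|w|` above.
-/

noncomputable section

open Set Filter Metric Complex Function
open _root_.Topology
open UpperHalfPlane (upperHalfPlaneSet isOpen_upperHalfPlaneSet)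
open Literature.Analysis.Complex
open scoped NNReal ComplexConjugate Real

namespace Literature.Probability.RandomPlanarGeometry

variable {A : Set ℂ} {γ γ' β β' : ℝ → ℂ} {s₀ : ℝ}

/-! ### The inner cone of a smooth hit path -/

/-- **Local geometry of a smooth hit path.** For `x < 1` close to `1`: the disc
`B(β x, |β'(1)|(1-x)/8)` lies in the interior of the hull, `(7/8)|β'(1)|(1-x) ≤ |β x - z₀| ≤
(9/8)|β'(1)|(1-x)`, and `|β'(x)| ≤ 2|β'(1)|`. (The arc `∂A ∩ ℍ` near `z₀` lies in the cone
`|N| ≤ |T|/2` of tangential/normal coordinates, while the disc has `|N| > 3|T|`, since `β'(1)`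
is normal; far arc points are far; a connected set off the arc meeting `int A` lies in `int A`.)
[folklore] -/
theorem IsSmoothHitPath.exists_local (hA : IsSmoothHullWith A γ γ') (hs₀ : s₀ ∈ Ioo (0 : ℝ) 1)
    (h : IsSmoothHitPath A γ γ' s₀ β β') :
    ∃ x₀ ∈ Ioo (0 : ℝ) 1, ∀ x ∈ Ico x₀ 1,
      ball (β x) (‖β' 1‖ / 8 * (1 - x)) ⊆ interior A ∧
      7 / 8 * ‖β' 1‖ * (1 - x) ≤ ‖β x - γ s₀‖ ∧ ‖β x - γ s₀‖ ≤ 9 / 8 * ‖β' 1‖ * (1 - x) ∧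
      ‖β' x‖ ≤ 2 * ‖β' 1‖ := by
  obtain ⟨-, hγ, hγ'c, hγ'ne, hinj, -, -, hIoo, hfrA⟩ := hA
  obtain ⟨hβd, hβ'c, hb0, hint, hβ1, hperp⟩ := h
  set z₀ : ℂ := γ s₀ with hz₀
  set v : ℂ := γ' s₀ with hvdef
  set b : ℂ := β' 1 with hbdef
  have hs₀I : s₀ ∈ Icc (0 : ℝ) 1 := ⟨hs₀.1.le, hs₀.2.le⟩
  have hv : v ≠ 0 := hγ'ne s₀ hs₀I
  have hν : 0 < ‖v‖ := norm_pos_iff.2 hv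
  have hbn : 0 < ‖b‖ := norm_pos_iff.2 hb0
  have hz₀im : 0 < z₀.im := hIoo s₀ hs₀
  have hγc : ContinuousOn γ (Icc 0 1) := fun t ht ↦ (hγ t ht).continuousWithinAt
  -- the arc near `z₀` is in the cone; far arc points are far
  obtain ⟨κ₁, hκ₁, hcone⟩ := exists_cone_of_hasDerivWithinAt (hγ s₀ hs₀I) hv
  obtain ⟨d₀, hd₀, hfar⟩ := exists_pos_le_norm_sub_of_far hγc hinj hs₀I hκ₁
  -- first-order expansion of `β` at `1`
  have hlo := (hasDerivWithinAt_iff_isLittleO.1 (hβd 1 ⟨zero_le_one, le_rfl⟩)).def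
    (show (0 : ℝ) < ‖b‖ / 8 by positivity)
  rw [eventually_nhdsWithin_iff, Metric.eventually_nhds_iff] at hlo
  obtain ⟨ρ₁, hρ₁, hexp⟩ := hlo
  -- continuity of `β'` at `1`
  have hc1 := hβ'c 1 ⟨zero_le_one, le_rfl⟩
  rw [Metric.continuousWithinAt_iff] at hc1
  obtain ⟨ρ₂, hρ₂, hder⟩ := hc1 ‖b‖ hbn
  -- the normal coordinate of `b`
  have hbv : |(b * conj v).im| = ‖b‖ * ‖v‖ := by
    have h1 : ‖b * conj v‖ ^ 2 = (b * conj v).re ^ 2 + (b * conj v).im ^ 2 := by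
      rw [Complex.sq_norm, Complex.normSq_apply]; ring
    rw [hperp] at h1
    have h2 : |(b * conj v).im| ^ 2 = (‖b‖ * ‖v‖) ^ 2 := by
      rw [sq_abs, ← Complex.norm_conj v, ← norm_mul, h1]
      ring
    exact (pow_left_inj₀ (abs_nonneg _) (by positivity) two_ne_zero).1 h2
  -- choice of `x₀`
  have hev : ∀ᶠ x₀ in 𝓝[<] (1 : ℝ), x₀ < 1 ∧ 0 < x₀ ∧ 1 - ρ₁ < x₀ ∧ 1 - ρ₂ < x₀ ∧
      1 - d₀ / (2 * ‖b‖) < x₀ ∧ 1 - z₀.im / (2 * ‖b‖) < x₀ := by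
    refine (eventually_mem_nhdsWithin).and ?_
    refine Filter.Eventually.filter_mono nhdsWithin_le_nhds ?_
    refine (eventually_gt_nhds one_pos).and ((eventually_gt_nhds (by linarith)).and
      ((eventually_gt_nhds (by linarith)).and ((eventually_gt_nhds ?_).and (eventually_gt_nhds ?_))))
    · have : 0 < d₀ / (2 * ‖b‖) := by positivity
      linarith
    · have : 0 < z₀.im / (2 * ‖b‖) := by positivity
      linarith
  obtain ⟨x₀, hx₀1, hx₀0, hx₀ρ₁, hx₀ρ₂, hx₀d, hx₀im⟩ := hev.exists
  have hx₀d' : 2 * ‖b‖ * (1 - x₀) < d₀ := by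
    have := (lt_div_iff₀ (by positivity : 0 < 2 * ‖b‖)).1 (sub_lt_comm.1 hx₀d)
    linarith
  have hx₀im' : 2 * ‖b‖ * (1 - x₀) < z₀.im := by
    have := (lt_div_iff₀ (by positivity : 0 < 2 * ‖b‖)).1 (sub_lt_comm.1 hx₀im)
    linarith
  refine ⟨x₀, ⟨hx₀0, hx₀1⟩, fun x hx ↦ ?_⟩
  have hxI : x ∈ Icc (0 : ℝ) 1 := ⟨hx₀0.le.trans hx.1, hx.2.le⟩
  have hx1 : 0 < 1 - x := by linarith [hx.2]
  have hxx₀ : 1 - x ≤ 1 - x₀ := by linarith [hx.1]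
  -- the remainder `r`
  set r : ℂ := β x - z₀ - ((x - 1 : ℝ) : ℂ) * b with hr
  have hrn : ‖r‖ ≤ ‖b‖ / 8 * (1 - x) := by
    have h1 := hexp (y := x) (by rw [dist_eq_norm, Real.norm_eq_abs, abs_sub_comm, abs_of_pos hx1]; linarith)
      hxI
    rw [hβ1, Real.norm_eq_abs, abs_sub_comm, abs_of_pos hx1, Complex.real_smul] at h1
    simpa [hr] using h1
  have hdecomp : β x - z₀ = ((x - 1 : ℝ) : ℂ) * b + r := by rw [hr]; ring
  have hmain : ‖((x - 1 : ℝ) : ℂ) * b‖ = (1 - x) * ‖b‖ := by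
    rw [norm_mul, Complex.norm_real, Real.norm_eq_abs, abs_sub_comm, abs_of_pos hx1]
  -- distance comparability
  have hlow : 7 / 8 * ‖b‖ * (1 - x) ≤ ‖β x - z₀‖ := by
    rw [hdecomp]
    have := norm_sub_norm_le (((x - 1 : ℝ) : ℂ) * b) (-r)
    rw [sub_neg_eq_add, norm_neg, hmain] at this
    nlinarith
  have hup : ‖β x - z₀‖ ≤ 9 / 8 * ‖b‖ * (1 - x) := by
    rw [hdecomp]
    refine (norm_add_le _ _).trans ?_
    rw [hmain]; nlinarith
  -- `‖β' x‖ ≤ 2‖b‖`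
  have hder' : ‖β' x‖ ≤ 2 * ‖b‖ := by
    have h1 := hder hxI (by rw [dist_eq_norm, Real.norm_eq_abs, abs_sub_comm, abs_of_pos hx1]; linarith)
    rw [dist_eq_norm] at h1
    have := norm_le_norm_add_norm_sub' (β' x) b
    rw [norm_sub_rev] at h1
    linarith [norm_sub_rev (β' x) b, norm_sub_le_norm_add (β' x) b,
      (norm_le_insert' (β' x) b : ‖β' x‖ ≤ ‖b‖ + ‖β' x - b‖)]
  refine ⟨?_, hlow, hup, hder'⟩
  -- the disc misses the arc and lies in `ℍ`
  set P : Set ℂ := ball (β x) (‖b‖ / 8 * (1 - x)) with hP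
  have hPz₀ : ∀ z ∈ P, ‖z - z₀‖ < 5 / 4 * ‖b‖ * (1 - x) := by
    intro z hz
    rw [hP, mem_ball, dist_eq_norm] at hz
    calc ‖z - z₀‖ = ‖(z - β x) + (β x - z₀)‖ := by ring_nf
      _ ≤ ‖z - β x‖ + ‖β x - z₀‖ := norm_add_le _ _
      _ < ‖b‖ / 8 * (1 - x) + 9 / 8 * ‖b‖ * (1 - x) := by linarith
      _ = 5 / 4 * ‖b‖ * (1 - x) := by ring
  have hPH : P ⊆ upperHalfPlaneSet := by
    intro z hz
    have h1 := hPz₀ z hz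
    have h2 : |(z - z₀).im| ≤ ‖z - z₀‖ := Complex.abs_im_le_norm _
    rw [Complex.sub_im] at h2
    show 0 < z.im
    nlinarith [(abs_le.1 h2).1, hbn]
  have hPγ : Disjoint P (γ '' Icc 0 1) := by
    rw [Set.disjoint_left]
    rintro z hz ⟨s, hs, rfl⟩
    have hzz₀ := hPz₀ _ hz
    by_cases hsκ : |s - s₀| < κ₁
    · -- near parameters: the cone versus the normal position of the disc
      obtain ⟨hNT, -⟩ := hcone s hs hsκ
      rw [hP, mem_ball, dist_eq_norm] at hz
      -- coordinates of `γ s`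
      have hcoord : (γ s - z₀) * conj v =
          (γ s - β x) * conj v + ((x - 1 : ℝ) : ℂ) * (b * conj v) + r * conj v := by
        rw [show γ s - z₀ = (γ s - β x) + (β x - z₀) by ring, hdecomp]; ring
      have hbvre : (((x - 1 : ℝ) : ℂ) * (b * conj v)).re = 0 := by
        rw [Complex.re_ofReal_mul, hperp, mul_zero]
      have hbvim : (((x - 1 : ℝ) : ℂ) * (b * conj v)).im = (x - 1) * (b * conj v).im := by
        rw [Complex.im_ofReal_mul]
      have hT : |((γ s - z₀) * conj v).re| ≤ ‖γ s - β x‖ * ‖v‖ + ‖r‖ * ‖v‖ := by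
        rw [hcoord, Complex.add_re, Complex.add_re, hbvre, add_zero]
        refine (abs_add_le _ _).trans (add_le_add ?_ ?_)
        · exact (Complex.abs_re_le_norm _).trans (by rw [norm_mul, Complex.norm_conj])
        · exact (Complex.abs_re_le_norm _).trans (by rw [norm_mul, Complex.norm_conj])
      have hN : (1 - x) * (‖b‖ * ‖v‖) - ‖γ s - β x‖ * ‖v‖ - ‖r‖ * ‖v‖ ≤
          |((γ s - z₀) * conj v).im| := by
        rw [hcoord, Complex.add_im, Complex.add_im, hbvim]
        have h1 : |(x - 1) * (b * conj v).im| = (1 - x) * (‖b‖ * ‖v‖) := by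
          rw [abs_mul, hbv, abs_sub_comm, abs_of_pos hx1]
        have h2 : |((γ s - β x) * conj v).im| ≤ ‖γ s - β x‖ * ‖v‖ :=
          (Complex.abs_im_le_norm _).trans (by rw [norm_mul, Complex.norm_conj])
        have h3 : |(r * conj v).im| ≤ ‖r‖ * ‖v‖ :=
          (Complex.abs_im_le_norm _).trans (by rw [norm_mul, Complex.norm_conj])
        have h4 := abs_sub_abs_le_abs_sub ((x - 1) * (b * conj v).im)
          (-(((γ s - β x) * conj v).im + (r * conj v).im))
        rw [abs_neg, sub_neg_eq_add, h1] at h4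
        have h5 := abs_add_le ((γ s - β x) * conj v).im ((r * conj v).im)
        have : (x - 1) * (b * conj v).im + (((γ s - β x) * conj v).im + (r * conj v).im) =
            ((γ s - β x) * conj v).im + (x - 1) * (b * conj v).im + (r * conj v).im := by ring
        rw [this] at h4
        linarith
      have hX : 0 < (1 - x) * (‖b‖ * ‖v‖) := by positivity
      have e1 : ‖γ s - β x‖ * ‖v‖ < ‖b‖ / 8 * (1 - x) * ‖v‖ := mul_lt_mul_of_pos_right hz hν
      have e2 : ‖r‖ * ‖v‖ ≤ ‖b‖ / 8 * (1 - x) * ‖v‖ := mul_le_mul_of_nonneg_right hrn hν.le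
      nlinarith
    · -- far parameters
      rw [not_lt] at hsκ
      have h1 := hfar s hs hsκ
      nlinarith
  have hPint : (P ∩ interior A).Nonempty :=
    ⟨β x, mem_ball_self (by positivity), hint x ⟨hxI.1, hx.2⟩⟩
  exact subset_interior_of_disjoint_arc hfrA (convex_ball _ _).isPreconnected hPH hPγ hPint

/-! ### The discharge -/

/-- **Discharge of the named fact `IsSmoothHull.hitPath_stolz`** ([LSW] proof of Lemma 6.3, the
sector claim): `|Re(g_T(β x) - W_T)| ≤ c Im(g_T(β x) - W_T)` on `[0, 1)`. Proof by hyperbolic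
geometry (the image curve is a quasi-geodesic of `ℍ`; module docstring).
[cite: LawlerSchrammWerner2003Restriction, proof of Lemma 6.3 (claim: β̂ ⊂ {|Re z| ≤ c Im z})] -/
theorem IsSmoothHull.hitPath_stolz_holds : IsSmoothHull.hitPath_stolz := by
  intro W hW A γ γ' hA hstar τ hτ hreal s₀ hs₀ hz₀cl β β' hβ
  -- notation
  set z₀ : ℂ := γ s₀ with hz₀
  set g : ℂ → ℂ := fun z ↦ Loewner.map W τ z - (W τ : ℂ) with hg
  set w : ℝ → ℂ := fun x ↦ g (β x) with hw
  set b : ℂ := β' 1 with hbdef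
  have hbn : 0 < ‖b‖ := norm_pos_iff.2 hβ.2.2.1
  have hAarc : IsArcHull A := hA.isSmoothHull.isArcHull
  have hintH : interior A ⊆ upperHalfPlaneSet := hA.1.interior_subset
  have hintD : interior A ⊆ Loewner.domain W τ := fun z hz ↦
    (Loewner.mem_domain_iff W τ z).2 ⟨hintH hz, hτ.lt_swallowingTime_of_mem_interior hW hAarc hreal hz⟩
  have hβD : ∀ x ∈ Ico (0 : ℝ) 1, β x ∈ Loewner.domain W τ := fun x hx ↦ hintD (hβ.mem_interior hx)
  have hwim : ∀ x ∈ Ico (0 : ℝ) 1, 0 < (w x).im := by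
    intro x hx
    simp only [hw, hg, Complex.sub_im, Complex.ofReal_im, sub_zero]
    exact Loewner.mapsTo_map hW τ (hβD x hx)
  have hβderiv : ∀ x ∈ Ioo (0 : ℝ) 1, HasDerivAt β (β' x) x := fun x hx ↦
    (hβ.1 x ⟨hx.1.le, hx.2.le⟩).hasDerivAt (Icc_mem_nhds hx.1 hx.2)
  have hgderiv : ∀ z ∈ Loewner.domain W τ, HasDerivAt g (deriv (Loewner.map W τ) z) z := by
    intro z hz
    have := ((Loewner.differentiableOn_map hW τ).differentiableAt
      ((Loewner.isOpen_domain hW τ).mem_nhds hz)).hasDerivAt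
    exact this.sub_const _
  set w' : ℝ → ℂ := fun x ↦ deriv (Loewner.map W τ) (β x) * β' x with hw'
  have hwderiv : ∀ x ∈ Ioo (0 : ℝ) 1, HasDerivAt w (w' x) x := fun x hx ↦
    (hgderiv (β x) (hβD x ⟨hx.1.le, hx.2⟩)).comp x (hβderiv x hx)
  -- local geometry and the choice of `x₀`
  obtain ⟨x₀, hx₀, hloc⟩ := hβ.exists_local hA hs₀
  have hsub0 : Ico x₀ 1 ⊆ Ico (0 : ℝ) 1 := fun x hx ↦ ⟨hx₀.1.le.trans hx.1, hx.2⟩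
  have hsub0' : Ico x₀ 1 ⊆ Ioo (0 : ℝ) 1 := fun x hx ↦ ⟨hx₀.1.trans_le hx.1, hx.2⟩
  -- (speed) `‖w'‖ / Im w ≤ 64/(1-x)` on `[x₀, 1)`
  have hspeed : ∀ x ∈ Ico x₀ 1, ‖w' x‖ / (w x).im ≤ 64 / (1 - x) := by
    intro x hx
    obtain ⟨hball, -, -, hder⟩ := hloc x hx
    have hx1 : 0 < 1 - x := by linarith [hx.2]
    have hr : 0 < ‖b‖ / 8 * (1 - x) := by positivity
    have hballD : ball (β x) (‖b‖ / 8 * (1 - x)) ⊆ Loewner.domain W τ := hball.trans hintD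
    have hK := Loewner.mul_norm_deriv_div_four_le_im hr
      ((Loewner.differentiableOn_map hW τ).mono hballD |>.sub_const (W τ : ℂ))
      (fun a ha c hc hac ↦ Loewner.injOn_map hW τ (hballD ha) (hballD hc) (sub_left_injective hac))
      (fun a ha ↦ by
        show 0 < (Loewner.map W τ a - (W τ : ℂ)).im
        rw [Complex.sub_im, Complex.ofReal_im, sub_zero]
        exact Loewner.mapsTo_map hW τ (hballD ha))
    have hdg : deriv (fun z ↦ Loewner.map W τ z - (W τ : ℂ)) (β x) = deriv (Loewner.map W τ) (β x) :=
      deriv_sub_const _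
    rw [hdg] at hK
    have him : 0 < (w x).im := hwim x (hsub0 hx)
    have him' : (Loewner.map W τ (β x) - (W τ : ℂ)).im = (w x).im := rfl
    rw [him'] at hK
    rw [div_le_div_iff₀ him hx1, hw']
    simp only [norm_mul]
    have h1 : ‖deriv (Loewner.map W τ) (β x)‖ * (‖b‖ / 8 * (1 - x)) ≤ 4 * (w x).im := by nlinarith
    calc ‖deriv (Loewner.map W τ) (β x)‖ * ‖β' x‖ * (1 - x)
        ≤ ‖deriv (Loewner.map W τ) (β x)‖ * (2 * ‖b‖) * (1 - x) := by gcongr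
      _ = 16 * (‖deriv (Loewner.map W τ) (β x)‖ * (‖b‖ / 8 * (1 - x))) := by ring
      _ ≤ 16 * (4 * (w x).im) := by gcongr
      _ = 64 * (w x).im := by ring
  -- polar coordinates of `w`
  set ψ : ℝ → ℝ := fun x ↦ Complex.arg (w x) with hψ
  set ψ' : ℝ → ℝ := fun x ↦ (w' x / w x).im with hψ'
  set R : ℝ → ℝ := fun x ↦ -Real.log ‖w x‖ with hR
  set R' : ℝ → ℝ := fun x ↦ -(w' x / w x).re with hR'
  -- the inverse map `f = (g_T - W_T)⁻¹ : ℍ → H_T`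
  set f : ℂ → ℂ := fun u ↦ Loewner.loewnerInv W τ (u + (W τ : ℂ)) with hf
  have hshift : ∀ u : ℂ, (u + (W τ : ℂ)).im = u.im := fun u ↦ by simp
  have hfd : DifferentiableOn ℂ f upperHalfPlaneSet := by
    refine (Loewner.differentiableOn_invFunOn_map hW τ).comp
      ((differentiable_id.add_const _).differentiableOn) fun u hu ↦ ?_
    show 0 < (u + (W τ : ℂ)).im
    rw [hshift]; exact hu
  have hfinj : InjOn f upperHalfPlaneSet := by
    intro u₁ h₁ u₂ h₂ heq
    have h₁' : 0 < (u₁ + (W τ : ℂ)).im := by rw [hshift]; exact h₁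
    have h₂' : 0 < (u₂ + (W τ : ℂ)).im := by rw [hshift]; exact h₂
    have := (Loewner.bijOn_invFunOn_map hW τ).injOn h₁' h₂' heq
    exact add_right_cancel this
  have hz₀D : z₀ ∉ Loewner.domain W τ := fun h ↦
    absurd hz₀cl.2 (not_le.2 ((Loewner.mem_domain_iff W τ z₀).1 h).2)
  have hfz₀ : z₀ ∉ f '' upperHalfPlaneSet := by
    rintro ⟨u, hu, hfu⟩
    have : f u ∈ Loewner.domain W τ :=
      Loewner.loewnerInv_mem_domain hW τ (by rw [hshift]; exact hu)
    rw [hfu] at this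
    exact hz₀D this
  have hfw : ∀ x ∈ Ico (0 : ℝ) 1, f (w x) = β x := by
    intro x hx
    simp only [hf, hw, hg, sub_add_cancel]
    exact Loewner.loewnerInv_map hW (hβD x hx)
  have hsin0 : ∀ x ∈ Ico (0 : ℝ) 1, 0 ≤ Real.sin (Complex.arg (w x)) := fun x hx ↦
    Real.sin_nonneg_of_nonneg_of_le_pi (QuasiGeodesic.arg_mem_Ioo_of_im_pos (hwim x hx)).1.le
      (Complex.arg_le_pi _)
  -- the quasi-geodesic structure
  have hQG : QuasiGeodesic.IsQuasiGeodesic ψ ψ' R R' x₀ 64 (1 / 4) (1 / 4 * Real.log (9 / 7)) := by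
    refine ⟨hx₀.2, by norm_num, by norm_num, ?_, ?_, ?_, ?_, ?_, ?_, ?_⟩
    · intro x hx; exact QuasiGeodesic.arg_mem_Ioo_of_im_pos (hwim x (hsub0 hx))
    · intro x hx
      exact (QuasiGeodesic.hasDerivAt_arg_comp (hwderiv x (hsub0' hx)) (hwim x (hsub0 hx))).1
    · intro x hx
      have h1 := (QuasiGeodesic.hasDerivAt_arg_comp (hwderiv x (hsub0' hx)) (hwim x (hsub0 hx))).2
      exact h1.trans (mul_le_mul_of_nonneg_left (hspeed x hx) (hsin0 x (hsub0 hx)))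
    · intro x hx
      exact (QuasiGeodesic.hasDerivAt_neg_log_norm_comp (hwderiv x (hsub0' hx)) (hwim x (hsub0 hx))).1
    · intro x hx
      have h1 := (QuasiGeodesic.hasDerivAt_neg_log_norm_comp (hwderiv x (hsub0' hx))
        (hwim x (hsub0 hx))).2
      exact h1.trans (mul_le_mul_of_nonneg_left (hspeed x hx) (hsin0 x (hsub0 hx)))
    · -- the distance inequality
      intro x₁ x₂ h₁ h₁₂ h₂
      have hx₁ : x₁ ∈ Ico x₀ 1 := ⟨h₁, lt_of_le_of_lt h₁₂ h₂⟩
      have hx₂ : x₂ ∈ Ico x₀ 1 := ⟨h₁.trans h₁₂, h₂⟩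
      obtain ⟨-, hlow₁, -, -⟩ := hloc x₁ hx₁
      obtain ⟨-, hlow₂, hup₂, -⟩ := hloc x₂ hx₂
      have hdist := QuasiGeodesic.abs_log_sub_log_le hfd hfinj hfz₀ (hwim x₁ (hsub0 hx₁))
        (hwim x₂ (hsub0 hx₂))
      rw [hfw x₁ (hsub0 hx₁), hfw x₂ (hsub0 hx₂)] at hdist
      have hx₁1 : 0 < 1 - x₁ := by linarith
      have hx₂1 : 0 < 1 - x₂ := by linarith
      have hpos₂ : 0 < ‖β x₂ - z₀‖ := lt_of_lt_of_le (by positivity) hlow₂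
      have e1 : Real.log (7 / 8 * ‖b‖ * (1 - x₁)) ≤ Real.log ‖β x₁ - z₀‖ :=
        Real.log_le_log (by positivity) hlow₁
      have e2 : Real.log ‖β x₂ - z₀‖ ≤ Real.log (9 / 8 * ‖b‖ * (1 - x₂)) :=
        Real.log_le_log hpos₂ hup₂
      have e3 : Real.log (7 / 8 * ‖b‖ * (1 - x₁)) - Real.log (9 / 8 * ‖b‖ * (1 - x₂)) =
          Real.log ((1 - x₁) / (1 - x₂)) - Real.log (9 / 7) := by
        rw [Real.log_mul (by positivity) hx₁1.ne', Real.log_mul (by positivity) hx₂1.ne',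
          Real.log_div hx₁1.ne' hx₂1.ne', Real.log_mul (by norm_num) hbn.ne',
          Real.log_mul (by norm_num) hbn.ne', Real.log_div (by norm_num) (by norm_num),
          Real.log_div (by norm_num) (by norm_num), Real.log_div (by norm_num) (by norm_num)]
        ring
      have e4 : Real.log ‖β x₁ - z₀‖ - Real.log ‖β x₂ - z₀‖ ≤
          |Real.log ‖β x₂ - z₀‖ - Real.log ‖β x₁ - z₀‖| := by
        rw [abs_sub_comm]; exact le_abs_self _
      have e5 : |Real.log ‖w x₁‖ - Real.log ‖w x₂‖| = |R x₂ - R x₁| := by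
        simp only [hR]; congr 1; ring
      have key : 1 / 4 * Real.log ((1 - x₁) / (1 - x₂)) - 1 / 4 * Real.log (9 / 7) ≤
          QuasiGeodesic.crown (Complex.arg (w x₁)) + |R x₂ - R x₁| +
            QuasiGeodesic.crown (Complex.arg (w x₂)) := by
        rw [← e5]; linarith
      exact key
    · -- `R → +∞`
      have ht := IsSmoothHull.hitPath_tendsto_holds hW hA hstar hτ hreal hs₀ hz₀cl hβ
      have hnorm : Tendsto (fun x ↦ ‖w x‖) (𝓝[<] 1) (𝓝[>] 0) := by
        refine tendsto_nhdsWithin_iff.2 ⟨?_, ?_⟩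
        · have := ht.norm
          simpa using this
        · filter_upwards [Ico_mem_nhdsLT one_pos] with x hx
          exact norm_pos_iff.2 fun h0 ↦ by have := hwim x hx; rw [h0] at this; simp at this
      exact tendsto_neg_atBot_atTop.comp (Real.tendsto_log_nhdsGT_zero.comp hnorm)
  -- the angle bound near `1`
  obtain ⟨δ, hδ, x₁, hx₁, hang⟩ := hQG.eventually_mem_Icc
  have hx₁0 : 0 ≤ x₁ := hx₀.1.le.trans hx₁.1
  have hδπ : δ ≤ π / 2 := by
    have := hang x₁ ⟨le_rfl, hx₁.2⟩
    simp only [hψ] at this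
    linarith [this.1, this.2]
  have hsinδ : 0 < Real.sin δ := Real.sin_pos_of_pos_of_lt_pi hδ (by linarith [Real.pi_pos])
  have hnear : ∀ x ∈ Ico x₁ 1, |(w x).re| ≤ 1 / Real.sin δ * (w x).im := by
    intro x hx
    have hx0 : x ∈ Ico (0 : ℝ) 1 := ⟨hx₁0.trans hx.1, hx.2⟩
    obtain ⟨h1, h2⟩ := hang x hx
    simp only [hψ] at h1 h2
    have him := hwim x hx0
    have hn : 0 < ‖w x‖ := norm_pos_iff.2 (by intro h0; rw [h0] at him; simp at him)
    have hsin : Real.sin δ ≤ Real.sin (Complex.arg (w x)) := by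
      rcases le_or_gt (Complex.arg (w x)) (π / 2) with hle | hgt
      · exact Real.sin_le_sin_of_le_of_le_pi_div_two (by linarith [Real.pi_pos]) hle h1
      · rw [← Real.sin_pi_sub (Complex.arg (w x))]
        exact Real.sin_le_sin_of_le_of_le_pi_div_two (by linarith [Real.pi_pos]) (by linarith)
          (by linarith)
    have himeq : (w x).im = ‖w x‖ * Real.sin (Complex.arg (w x)) := by
      rw [Complex.sin_arg]; field_simp
    have h3 : ‖w x‖ * Real.sin δ ≤ (w x).im := by rw [himeq]; gcongr
    rw [one_div, inv_mul_eq_div, le_div_iff₀ hsinδ]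
    calc |(w x).re| * Real.sin δ ≤ ‖w x‖ * Real.sin δ := by
          gcongr; exact Complex.abs_re_le_norm _
      _ ≤ (w x).im := h3
  -- the compact part `[0, x₁]`
  have hcont : ContinuousOn w (Icc 0 x₁) := by
    intro x hx
    have hx0 : x ∈ Ico (0 : ℝ) 1 := ⟨hx.1, lt_of_le_of_lt hx.2 hx₁.2⟩
    have h1 : ContinuousWithinAt β (Icc 0 x₁) x :=
      (hβ.continuousOn x ⟨hx.1, hx.2.trans hx₁.2.le⟩).mono (Icc_subset_Icc_right hx₁.2.le)
    exact (hgderiv (β x) (hβD x hx0)).continuousAt.comp_continuousWithinAt h1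
  obtain ⟨m, hm, hmle⟩ : ∃ m > 0, ∀ x ∈ Icc 0 x₁, m ≤ (w x).im := by
    have hc : ContinuousOn (fun x ↦ (w x).im) (Icc 0 x₁) :=
      Complex.continuous_im.comp_continuousOn hcont
    obtain ⟨xm, hxm, hmin⟩ := isCompact_Icc.exists_isMinOn (nonempty_Icc.2 hx₁0) hc
    exact ⟨(w xm).im, hwim xm ⟨hxm.1, lt_of_le_of_lt hxm.2 hx₁.2⟩, fun x hx ↦ hmin hx⟩
  obtain ⟨M, hMle⟩ : ∃ M, ∀ x ∈ Icc 0 x₁, ‖w x‖ ≤ M := by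
    obtain ⟨xM, -, hmax⟩ := isCompact_Icc.exists_isMaxOn (nonempty_Icc.2 hx₁0) hcont.norm
    exact ⟨‖w xM‖, fun x hx ↦ hmax hx⟩
  refine ⟨max (1 / Real.sin δ) (M / m), fun x hx ↦ ?_⟩
  have himx : 0 ≤ (w x).im := (hwim x hx).le
  rcases lt_or_ge x x₁ with hlt | hge
  · have hxI : x ∈ Icc 0 x₁ := ⟨hx.1, hlt.le⟩
    have him := hmle x hxI
    have hM0 : 0 ≤ M := (norm_nonneg _).trans (hMle x hxI)
    have hMm : 0 ≤ M / m := div_nonneg hM0 hm.le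
    calc |(w x).re| ≤ ‖w x‖ := Complex.abs_re_le_norm _
      _ ≤ M := hMle x hxI
      _ = M / m * m := by field_simp
      _ ≤ M / m * (w x).im := by gcongr
      _ ≤ max (1 / Real.sin δ) (M / m) * (w x).im :=
          mul_le_mul_of_nonneg_right (le_max_right _ _) himx
  · calc |(w x).re| ≤ 1 / Real.sin δ * (w x).im := hnear x ⟨hge, hx.2⟩
      _ ≤ max (1 / Real.sin δ) (M / m) * (w x).im :=
          mul_le_mul_of_nonneg_right (le_max_left _ _) himx

end Literature.Probability.RandomPlanarGeometry
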